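import Mathlib.RingTheory.Ideal.AssociatedPrime.Basic
import Mathlib.RingTheory.Localization.AtPrime.Basic
import Mathlib.RingTheory.Localization.Ideal
import Literature.AlgebraicGeometry.Resolution.CobordantBlowupRegularCentre
import Literature.AlgebraicGeometry.Resolution.CobordantBlowupExtReesBridge
import HarnessLib

/-!
# E2 centre, ring-level hand (M2): the weighted monomial ideals of a regular weighted chart are
# `(U)`-primary along `V(U)` — associated primes and the AGREEMENT TOOL

[OURS · L1 W4.3 · DOOR `HypersurfaceCentreConstruction` stmt-ResolutionOfSingularities-19897 · E2 tier, centre piece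
(C-c) `E2CentreGlueBody`, DESIGN MEMO v0 `L/res-L1-w43-plan-1/E2-CENTRE-GLUE-DESIGN-v0.md` (registrar res-L1-w43-plan-1)
§1 (M2); ring-level hand res-L1-s36-pv-1.  Plain commutative algebra about the tree's `weightedMonomialIdeal`
(`Literature/AlgebraicGeometry/Resolution/WeightedResolutionDatum`); nothing here is a statement of, or about, the
manuscript under adjudication (Hironaka 2017); candidate-design support, AI-written, weaker than expert review.]

## Setting and results

`A` a commutative ring, `u : Fin N → A`, positive weights `w : Fin N → ℕ`, and the weighted monomial ideals
`𝒥ₙ := weightedMonomialIdeal u w n = (u^α : Σ wᵢ αᵢ ≥ n)` — the LOCAL MODELS `I_n = 𝒥ₙ(U, W)·A_h` of the memo.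
The standing hypothesis `hloc` is the tree's "regular weighted chart" hypothesis
(`cobordantAlgebra.isRegularRing_of_linearIndependent_toCotangent`, Włodarczyk Def. 2.1.10): at every prime `P ⊇ (u)`
some localisation of `A` at `P` is a regular local ring in whose cotangent space the `uᵢ` are linearly independent.

* `mem_weightedMonomialIdeal_of_mul_mem` — LOCAL NON-ZERO-DIVISOR LEMMA: in a regular local ring in which the `uᵢ`
  have independent differentials, every `x ∉ (u)` is a non-zero-divisor modulo every `𝒥ₙ`
  (the colon lemma (C) of `WeightedMonomialIdeals.lean` + primality of the `(u_T)`, `RegularQuotientIdeal.lean`).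
* `mem_minimalPrimes_of_forall_mem_iff_mul_mem` — under `hloc`, a prime of the form `P = (𝒥ₙ : z)` is a MINIMAL
  prime of `(u)`; `associatedPrimes_quotient_subset_minimalPrimes` — hence (Noetherian)
  `Ass(A ⧸ 𝒥ₙ) ⊆ Min((u))`: the weighted monomial ideals have NO EMBEDDED COMPONENTS and are `(u)`-primary along
  `V(u)` ("`Ass ⊆ Min(U)`" of the memo).
* `le_weightedMonomialIdeal_iff_forall_minimalPrimes` — THE AGREEMENT TOOL (Noetherian `A`): an ideal `K` lies in
  `𝒥ₙ` iff it does so locally at every minimal prime of `(u)` (`∀ 𝔮 ∈ Min((u)), ∀ y ∈ K, ∃ s ∉ 𝔮, s y ∈ 𝒥ₙ`), with the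
  localised form `le_weightedMonomialIdeal_iff_forall_map_le` (`K A_𝔮 ≤ 𝒥ₙ A_𝔮` at the minimal primes) and the
  transfer `forall_exists_mul_mem_iff_map_le` to ANY localisation at `𝔮` (e.g. a stalk);
  `weightedMonomialIdeal_eq_of_forall_minimalPrimes` — two ideals without embedded components off `Min((u))` that agree
  locally at the minimal primes are equal (shape used by (G-2) AGREEMENT of two charts).
* support bookkeeping for (M1)/(G-4): `weightedMonomialIdeal_le_span_range` (`𝒥ₙ ≤ (u)` for `n ≥ 1`),
  `pow_mem_weightedMonomialIdeal'`, `radical_weightedMonomialIdeal_eq` (`√𝒥ₙ = √(u)` for `n ≥ 1`),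
  `minimalPrimes_weightedMonomialIdeal_eq`, and `map_weightedMonomialIdeal'` (`𝒥ₙ(u)·B = 𝒥ₙ(φ ∘ u)`).

Sources of the mathematics: H. Matsumura, *Commutative Ring Theory* (1986), Thm. 16.2 (regular ⇒ quasi-regular; the
weighted colon lemmas are the tree's `colon_weightedSpan_aux`), Thm. 6.1/6.5 (associated primes and localisation);
J. Włodarczyk, arXiv:2203.03090, Def. 2.1.10, Lemma 2.1.12 (the ideals `(u^α : Σ αᵢ wᵢ ≥ a)`).
-/

set_option linter.dupNamespace false

noncomputable section

open IsLocalRing Literature.AlgebraicGeometry.Resolution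

namespace Summit.ResolutionOfSingularities.ResolutionOfSingularities.Cruxes.HypersurfaceCentreConstruction.LocalEngine

namespace E2Model

universe u

/-! ## §0 Elementary bookkeeping on `weightedMonomialIdeal` -/

section Elementary

variable {A : Type u} [CommRing A] {N : ℕ} (u : Fin N → A) (w : Fin N → ℕ)

/-- The weighted monomial ideals extend generator by generator along a ring map:
`𝒥ₙ(u, w)·B = 𝒥ₙ(φ ∘ u, w)`. [OURS · folklore bookkeeping for DESIGN MEMO v0 §1] -/
theorem map_weightedMonomialIdeal' {B : Type*} [CommRing B] (φ : A →+* B) (n : ℕ) :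
    (weightedMonomialIdeal u w n).map φ = weightedMonomialIdeal (⇑φ ∘ u) w n := by
  unfold weightedMonomialIdeal
  rw [Ideal.map_span]
  congr 1
  ext x
  constructor
  · rintro ⟨_, ⟨α, hα, rfl⟩, rfl⟩
    exact ⟨α, hα, by simp [map_prod, map_pow]⟩
  · rintro ⟨α, hα, rfl⟩
    exact ⟨∏ i, u i ^ α i, ⟨α, hα, rfl⟩, by simp [map_prod, map_pow]⟩

/-- `uᵢ ^ n ∈ 𝒥ₙ` as soon as `wᵢ > 0`. [OURS · folklore bookkeeping] -/
theorem pow_mem_weightedMonomialIdeal' (i : Fin N) (hwi : 0 < w i) (n : ℕ) :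
    u i ^ n ∈ weightedMonomialIdeal u w n := by
  classical
  refine Ideal.subset_span ⟨Pi.single i n, ?_, ?_⟩
  · calc n ≤ w i * n := Nat.le_mul_of_pos_left n hwi
      _ = ∑ j, w j * (Pi.single i n : Fin N → ℕ) j := by
          rw [Finset.sum_eq_single i]
          · simp
          · intro j _ hj; simp [Pi.single_eq_of_ne hj]
          · intro h; exact absurd (Finset.mem_univ i) h
  · rw [Finset.prod_eq_single i]
    · simp
    · intro j _ hj; simp [Pi.single_eq_of_ne hj]
    · intro h; exact absurd (Finset.mem_univ i) h

/-- For `n ≥ 1` every generating monomial has a factor `uᵢ`, so `𝒥ₙ ≤ (u)`. [OURS · folklore bookkeeping] -/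
theorem weightedMonomialIdeal_le_span_range {n : ℕ} (hn : 1 ≤ n) :
    weightedMonomialIdeal u w n ≤ Ideal.span (Set.range u) := by
  unfold weightedMonomialIdeal
  refine Ideal.span_le.mpr ?_
  rintro x ⟨α, hα, rfl⟩
  -- some exponent is positive
  have hex : ∃ i, 0 < α i := by
    by_contra h
    simp only [not_exists, not_lt, Nat.le_zero] at h
    have : ∑ i, w i * α i = 0 := Finset.sum_eq_zero fun i _ => by simp [h i]
    omega
  obtain ⟨i, hi⟩ := hex
  have hdvd : u i ∣ ∏ j, u j ^ α j := by
    refine (dvd_pow_self (u i) hi.ne').trans ?_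
    exact Finset.dvd_prod_of_mem (fun j => u j ^ α j) (Finset.mem_univ i)
  exact Ideal.mem_of_dvd _ hdvd (Ideal.subset_span ⟨i, rfl⟩)

/-- For positive weights and `n ≥ 1`: `√𝒥ₙ = √(u)`. [OURS · folklore bookkeeping for (M1)/(G-4): the support of the
local model is `V(u)`] -/
theorem radical_weightedMonomialIdeal_eq (hw : ∀ i, 0 < w i) {n : ℕ} (hn : 1 ≤ n) :
    (weightedMonomialIdeal u w n).radical = (Ideal.span (Set.range u)).radical := by
  refine le_antisymm (Ideal.radical_mono (weightedMonomialIdeal_le_span_range u w hn)) ?_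
  refine Ideal.radical_le_radical_iff.mpr (Ideal.span_le.mpr ?_)
  rintro _ ⟨i, rfl⟩
  exact ⟨n, pow_mem_weightedMonomialIdeal' u w i (hw i) n⟩

/-- For positive weights and `n ≥ 1` the minimal primes of `𝒥ₙ` are those of `(u)`. [OURS · folklore bookkeeping] -/
theorem minimalPrimes_weightedMonomialIdeal_eq (hw : ∀ i, 0 < w i) {n : ℕ} (hn : 1 ≤ n) :
    (weightedMonomialIdeal u w n).minimalPrimes = (Ideal.span (Set.range u)).minimalPrimes := by
  rw [← Ideal.radical_minimalPrimes, radical_weightedMonomialIdeal_eq u w hw hn, Ideal.radical_minimalPrimes]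

/-- The generating set of `𝒥ₙ` in the finitely-supported rendering of `WeightedMonomialIdeals.lean` (all of `Fin N`
allowed as support) is the generating set `weightedMonomials u w n` of the weighted filtration. [OURS · bookkeeping] -/
private theorem setOf_finsupp_eq_weightedMonomials (n : ℕ) :
    {x : A | ∃ β : Fin N →₀ ℕ, (↑β.support : Set (Fin N)) ⊆ ↑(Finset.univ : Finset (Fin N)) ∧
      n ≤ Finsupp.weight w β ∧ β.prod (fun i e => u i ^ e) = x} = weightedMonomials u w n := by
  ext x
  simp only [Finset.coe_univ, Set.subset_univ, true_and, Set.mem_setOf_eq, weightedMonomials]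

/-- `𝒥ₙ` equals the span of the finitely-supported generating set (so that the colon lemmas of
`WeightedMonomialIdeals.lean` apply verbatim). [OURS · bookkeeping] -/
private theorem weightedMonomialIdeal_eq_span_finsupp (n : ℕ) :
    weightedMonomialIdeal u w n = Ideal.span {x : A | ∃ β : Fin N →₀ ℕ,
      (↑β.support : Set (Fin N)) ⊆ ↑(Finset.univ : Finset (Fin N)) ∧
      n ≤ Finsupp.weight w β ∧ β.prod (fun i e => u i ^ e) = x} := by
  rw [setOf_finsupp_eq_weightedMonomials, weightedMonomialIdeal_eq_weightedFiltration_ideal,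
    weightedFiltration_ideal]

end Elementary

/-! ## §1 The local non-zero-divisor lemma (regular local ring, independent differentials) -/

section Local

variable {R : Type u} [CommRing R] [IsRegularLocalRing R] {N : ℕ} (u : Fin N → R) (w : Fin N → ℕ)

/-- **LOCAL NON-ZERO-DIVISOR LEMMA.** In a regular local ring `R`, let `u₁, …, u_N ∈ 𝔪` have linearly independent
images in `𝔪/𝔪²` and let the weights be positive. Then every `x ∉ (u)` is a non-zero-divisor modulo every weighted
monomial ideal: `x y ∈ 𝒥ₙ ⇒ y ∈ 𝒥ₙ`, i.e. `(𝒥ₙ : x) = 𝒥ₙ`. (The `(u_T)`, `T ⊆ {1..N}`, are prime —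
`isPrime_span_image_of_linearIndependent_toCotangent` — and do not contain `x`; the `uᵢ` form a permutable regular
family, so the colon lemma (C) `colon_weightedSpan_aux` applies.) [OURS · DESIGN MEMO v0 §1 (M2), local form] -/
theorem mem_weightedMonomialIdeal_of_mul_mem (hw : ∀ i, 0 < w i) (hmem : ∀ i, u i ∈ maximalIdeal R)
    (hli : LinearIndependent (ResidueField R) fun i => (maximalIdeal R).toCotangent ⟨u i, hmem i⟩)
    {x : R} (hx : x ∉ Ideal.span (Set.range u)) {n : ℕ} {y : R}
    (hxy : x * y ∈ weightedMonomialIdeal u w n) : y ∈ weightedMonomialIdeal u w n := by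
  classical
  -- permutable regularity of the family (all of `Fin N`), modulo `K = ⊥`
  have hperm : ∀ i ∈ (Finset.univ : Finset (Fin N)), ∀ T : Set (Fin N),
      T ⊆ ↑(Finset.univ : Finset (Fin N)) → i ∉ T → ∀ z : R,
      u i * z ∈ (⊥ : Ideal R) ⊔ Ideal.span (u '' T) → z ∈ (⊥ : Ideal R) ⊔ Ideal.span (u '' T) := by
    intro i _ T _ hiT z hz
    rw [bot_sup_eq] at hz ⊢
    exact mem_span_image_of_mul_mem_of_linearIndependent_toCotangent u hmem hli i T hiT z hz
  -- `x` is a non-zero-divisor modulo every `(u_T)`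
  have hxT : ∀ T : Set (Fin N), T ⊆ ↑(Finset.univ : Finset (Fin N)) → ∀ z : R,
      x * z ∈ (⊥ : Ideal R) ⊔ Ideal.span (u '' T) → z ∈ (⊥ : Ideal R) ⊔ Ideal.span (u '' T) := by
    intro T _ z hz
    rw [bot_sup_eq] at hz ⊢
    have hprime := isPrime_span_image_of_linearIndependent_toCotangent u hmem hli T
    refine (hprime.mem_or_mem hz).resolve_left fun hxT => hx ?_
    exact Ideal.span_mono (Set.image_subset_range u T) hxT
  have key := (colon_weightedSpan_aux u w Finset.univ ⊥ (fun i _ => hw i) hperm).1 x hxT n y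
  rw [bot_sup_eq, ← weightedMonomialIdeal_eq_span_finsupp] at key
  exact key hxy

end Local

/-! ## §2 Regular weighted charts: associated primes of `A ⧸ 𝒥ₙ` are minimal primes of `(u)` -/

section Chart

variable {A : Type u} [CommRing A] {N : ℕ} (u : Fin N → A) (w : Fin N → ℕ) (hw : ∀ i, 0 < w i)
  (hloc : ∀ (P : Ideal A) [P.IsPrime], Ideal.span (Set.range u) ≤ P →
    ∃ (R : Type u) (_ : CommRing R) (_ : Algebra A R) (_ : IsLocalization.AtPrime R P)
      (_ : IsRegularLocalRing R) (hmem : ∀ i, algebraMap A R (u i) ∈ maximalIdeal R),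
      LinearIndependent (ResidueField R)
        fun i => (maximalIdeal R).toCotangent ⟨algebraMap A R (u i), hmem i⟩)

include hw in
/-- A prime of the form `P = (𝒥ₙ : z)` contains `(u)` (as `uᵢⁿ ∈ 𝒥ₙ`). [OURS · bookkeeping] -/
theorem span_range_le_of_forall_mem_iff_mul_mem {n : ℕ} {P : Ideal A} [P.IsPrime] {z : A}
    (hP : ∀ a, a ∈ P ↔ a * z ∈ weightedMonomialIdeal u w n) : Ideal.span (Set.range u) ≤ P := by
  refine Ideal.span_le.mpr ?_
  rintro _ ⟨i, rfl⟩
  refine ‹P.IsPrime›.mem_of_pow_mem n ((hP _).mpr ?_)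
  exact Ideal.mul_mem_right _ _ (pow_mem_weightedMonomialIdeal' u w i (hw i) n)

include hw hloc in
/-- **NO EMBEDDED COMPONENTS.** On a regular weighted chart, a prime ideal of the form `P = (𝒥ₙ : z)` — i.e. an
associated prime of `A ⧸ 𝒥ₙ` — is a MINIMAL prime of `(u)`.  Proof: `(u) ≤ P`; in the regular localisation `R` at `P`
every element of `P R` lies in `(u) R` (otherwise it is a non-zero-divisor modulo `𝒥ₙ R` by
`mem_weightedMonomialIdeal_of_mul_mem`, forcing `z ∈ 𝒥ₙ R`, i.e. `s z ∈ 𝒥ₙ` for some `s ∉ P`, i.e. `s ∈ P`); so a prime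
`𝔮 ⊆ P` containing `(u)` has `P R ≤ 𝔮 R`, whence `P ≤ 𝔮`. [OURS · DESIGN MEMO v0 §1 (M2) "`Ass ⊆ Min(U)`"] -/
theorem mem_minimalPrimes_of_forall_mem_iff_mul_mem {n : ℕ} {P : Ideal A} [hPp : P.IsPrime] {z : A}
    (hP : ∀ a, a ∈ P ↔ a * z ∈ weightedMonomialIdeal u w n) :
    P ∈ (Ideal.span (Set.range u)).minimalPrimes := by
  have hUP := span_range_le_of_forall_mem_iff_mul_mem u w hw hP
  obtain ⟨R, _, _, _, _, hmem, hli⟩ := hloc P hUP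
  -- every element of `P` maps into `(u) R`
  have hPmap : ∀ x ∈ P, algebraMap A R x ∈ Ideal.span (Set.range (⇑(algebraMap A R) ∘ u)) := by
    intro x hx
    by_contra hxu
    have hxz : algebraMap A R x * algebraMap A R z ∈ weightedMonomialIdeal (⇑(algebraMap A R) ∘ u) w n := by
      rw [← map_mul, ← map_weightedMonomialIdeal']
      exact Ideal.mem_map_of_mem _ ((hP x).mp hx)
    have hz : algebraMap A R z ∈ (weightedMonomialIdeal u w n).map (algebraMap A R) := by
      rw [map_weightedMonomialIdeal']
      exact mem_weightedMonomialIdeal_of_mul_mem _ w hw hmem hli hxu hxz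
    obtain ⟨⟨⟨a, ha⟩, s⟩, hs⟩ := (IsLocalization.mem_map_algebraMap_iff P.primeCompl R).mp hz
    simp only at hs
    rw [← map_mul] at hs
    obtain ⟨c, hc⟩ := (IsLocalization.eq_iff_exists P.primeCompl R).mp hs
    -- `(c s) z = c a ∈ 𝒥ₙ`, so `c s ∈ P`: contradiction
    have hcs : (c : A) * s * z ∈ weightedMonomialIdeal u w n := by
      have : (c : A) * s * z = c * a := by rw [← hc]; ring
      rw [this]
      exact Ideal.mul_mem_left _ _ ha
    rcases hPp.mem_or_mem ((hP _).mpr hcs) with h | h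
    · exact c.2 h
    · exact s.2 h
  refine ⟨⟨hPp, hUP⟩, ?_⟩
  rintro 𝔮 ⟨h𝔮, hU𝔮⟩ h𝔮P
  intro x hx
  have hdisj : Disjoint (P.primeCompl : Set A) 𝔮 :=
    Set.disjoint_left.mpr fun a ha ha𝔮 => ha (h𝔮P ha𝔮)
  have hx' : algebraMap A R x ∈ 𝔮.map (algebraMap A R) := by
    refine (show Ideal.span (Set.range (⇑(algebraMap A R) ∘ u)) ≤ 𝔮.map (algebraMap A R) from ?_) (hPmap x hx)
    rw [Set.range_comp, ← Ideal.map_span]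
    exact Ideal.map_mono hU𝔮
  have := IsLocalization.under_map_of_isPrime_disjoint P.primeCompl R h𝔮 hdisj
  rw [← this]
  exact hx'

include hw hloc in
/-- The same in the language of Mathlib's associated primes (Noetherian `A`): every associated prime of `A ⧸ 𝒥ₙ` is a
minimal prime of `(u)` — the weighted monomial ideals of a regular weighted chart have no embedded components.
[OURS · DESIGN MEMO v0 §1 (M2) "`Ass ⊆ Min(U)`"] -/
theorem associatedPrimes_quotient_subset_minimalPrimes [IsNoetherianRing A] (n : ℕ) :
    associatedPrimes A (A ⧸ weightedMonomialIdeal u w n) ⊆ (Ideal.span (Set.range u)).minimalPrimes := by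
  intro P hPass
  rw [AssociatedPrimes.mem_iff, isAssociatedPrime_iff] at hPass
  obtain ⟨hPp, z', hz'⟩ := hPass
  obtain ⟨z, rfl⟩ := Ideal.Quotient.mk_surjective z'
  haveI := hPp
  refine mem_minimalPrimes_of_forall_mem_iff_mul_mem u w hw hloc (n := n) (z := z) fun a => ?_
  rw [hz', Submodule.mem_colon_singleton, Submodule.mem_bot, Algebra.smul_def, Ideal.Quotient.algebraMap_eq,
    ← map_mul, Ideal.Quotient.eq_zero_iff_mem]

/-! ## §3 THE AGREEMENT TOOL -/

include hw hloc in
/-- **THE AGREEMENT TOOL** (DESIGN MEMO v0 §1 (M2), CONSEQUENCE). On a regular weighted chart over a Noetherian ring, an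
ideal `K` lies in the weighted monomial ideal `𝒥ₙ` iff it does so LOCALLY AT THE MINIMAL PRIMES OF `(u)` (= the generic
points `ζ` of `V(u)`): `K ≤ 𝒥ₙ ↔ ∀ 𝔮 ∈ Min((u)), ∀ y ∈ K, ∃ s ∉ 𝔮, s y ∈ 𝒥ₙ`.  Proof of `←`: if `y ∈ K ∖ 𝒥ₙ`, an
associated prime `P ⊇ (𝒥ₙ : y)` of `A ⧸ 𝒥ₙ` exists (Noetherian), it is a minimal prime of `(u)`
(`mem_minimalPrimes_of_forall_mem_iff_mul_mem`), and the hypothesis at `P` produces `s ∈ (𝒥ₙ : y) ⊆ P` with `s ∉ P`.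
[OURS · DESIGN MEMO v0 §1 (M2)] -/
theorem le_weightedMonomialIdeal_iff_forall_minimalPrimes [IsNoetherianRing A] {n : ℕ} {K : Ideal A} :
    K ≤ weightedMonomialIdeal u w n ↔
      ∀ 𝔮 ∈ (Ideal.span (Set.range u)).minimalPrimes, ∀ y ∈ K,
        ∃ s ∉ 𝔮, s * y ∈ weightedMonomialIdeal u w n := by
  constructor
  · intro hK 𝔮 h𝔮 y hy
    exact ⟨1, fun h1 => h𝔮.1.1.ne_top ((Ideal.eq_top_iff_one _).mpr h1), by simpa using hK hy⟩
  · intro hK y hy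
    by_contra hyJ
    set J := weightedMonomialIdeal u w n with hJ
    have hne : Ideal.Quotient.mk J y ≠ 0 := fun h => hyJ (Ideal.Quotient.eq_zero_iff_mem.mp h)
    obtain ⟨P, hPass, hle⟩ := exists_le_isAssociatedPrime_of_isNoetherianRing A (Ideal.Quotient.mk J y) hne
    rw [isAssociatedPrime_iff] at hPass
    obtain ⟨hPp, z', hz'⟩ := hPass
    obtain ⟨z, rfl⟩ := Ideal.Quotient.mk_surjective z'
    haveI := hPp
    have hPmin : P ∈ (Ideal.span (Set.range u)).minimalPrimes := by
      refine mem_minimalPrimes_of_forall_mem_iff_mul_mem u w hw hloc (n := n) (z := z) fun a => ?_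
      rw [hz', Submodule.mem_colon_singleton, Submodule.mem_bot, Algebra.smul_def, Ideal.Quotient.algebraMap_eq,
        ← map_mul, Ideal.Quotient.eq_zero_iff_mem]
    obtain ⟨s, hsP, hsy⟩ := hK P hPmin y hy
    refine hsP (hle ?_)
    rw [Submodule.mem_colon_singleton, Submodule.mem_bot, Algebra.smul_def, Ideal.Quotient.algebraMap_eq, ← map_mul,
      Ideal.Quotient.eq_zero_iff_mem]
    exact hsy

omit hw hloc in
/-- Transfer between the elementwise local condition at a prime `𝔮` and containment of the extended ideals in ANY
localisation `Rq` of `A` at `𝔮` (a stalk, `Localization.AtPrime 𝔮`, …): `(∀ y ∈ K, ∃ s ∉ 𝔮, s y ∈ J) ↔ K Rq ≤ J Rq`.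
[OURS · bookkeeping for the scheme-level hand] -/
theorem forall_exists_mul_mem_iff_map_le (𝔮 : Ideal A) [𝔮.IsPrime] (Rq : Type*) [CommRing Rq] [Algebra A Rq]
    [IsLocalization.AtPrime Rq 𝔮] (K J : Ideal A) :
    (∀ y ∈ K, ∃ s ∉ 𝔮, s * y ∈ J) ↔ K.map (algebraMap A Rq) ≤ J.map (algebraMap A Rq) := by
  constructor
  · intro h
    refine (Ideal.map_le_iff_le_comap).mpr fun y hy => ?_
    obtain ⟨s, hs, hsy⟩ := h y hy
    rw [Ideal.mem_comap]
    have hunit : IsUnit (algebraMap A Rq s) := IsLocalization.map_units Rq (⟨s, hs⟩ : 𝔮.primeCompl)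
    have hmem : algebraMap A Rq s * algebraMap A Rq y ∈ J.map (algebraMap A Rq) := by
      rw [← map_mul]; exact Ideal.mem_map_of_mem _ hsy
    exact (Ideal.unit_mul_mem_iff_mem _ hunit).mp hmem
  · intro h y hy
    have hy' : algebraMap A Rq y ∈ J.map (algebraMap A Rq) := h (Ideal.mem_map_of_mem _ hy)
    obtain ⟨⟨⟨a, ha⟩, s⟩, hs⟩ := (IsLocalization.mem_map_algebraMap_iff 𝔮.primeCompl Rq).mp hy'
    simp only at hs
    rw [← map_mul] at hs
    obtain ⟨c, hc⟩ := (IsLocalization.eq_iff_exists 𝔮.primeCompl Rq).mp hs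
    refine ⟨c * s, fun h => ?_, ?_⟩
    · rcases ‹𝔮.IsPrime›.mem_or_mem h with h | h
      · exact c.2 h
      · exact s.2 h
    · have : (c : A) * s * y = c * a := by rw [← hc]; ring
      rw [this]
      exact Ideal.mul_mem_left _ _ ha

include hw hloc in
/-- **THE AGREEMENT TOOL, localised form**: `K ≤ 𝒥ₙ ↔ K A_𝔮 ≤ 𝒥ₙ A_𝔮` for every minimal prime `𝔮` of `(u)`.
[OURS · DESIGN MEMO v0 §1 (M2)] -/
theorem le_weightedMonomialIdeal_iff_forall_map_le [IsNoetherianRing A] {n : ℕ} {K : Ideal A} :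
    K ≤ weightedMonomialIdeal u w n ↔
      ∀ (𝔮 : Ideal A) [𝔮.IsPrime], 𝔮 ∈ (Ideal.span (Set.range u)).minimalPrimes →
        K.map (algebraMap A (Localization.AtPrime 𝔮)) ≤
          (weightedMonomialIdeal u w n).map (algebraMap A (Localization.AtPrime 𝔮)) := by
  rw [le_weightedMonomialIdeal_iff_forall_minimalPrimes u w hw hloc]
  constructor
  · intro h 𝔮 _ h𝔮
    exact (forall_exists_mul_mem_iff_map_le 𝔮 (Localization.AtPrime 𝔮) K _).mp (h 𝔮 h𝔮)
  · intro h 𝔮 h𝔮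
    haveI := h𝔮.1.1
    exact (forall_exists_mul_mem_iff_map_le 𝔮 (Localization.AtPrime 𝔮) K _).mpr (h 𝔮 h𝔮)

include hw hloc in
/-- **Equality from local agreement at the generic points** (shape of (G-2)): on a regular weighted chart over a
Noetherian ring, an ideal `K ⊇ 𝒥ₙ` that lies in `𝒥ₙ` locally at the minimal primes of `(u)` IS `𝒥ₙ`:
`K = 𝒥ₙ ↔ 𝒥ₙ ≤ K ∧ ∀ 𝔮 ∈ Min((u)), ∀ y ∈ K, ∃ s ∉ 𝔮, s y ∈ 𝒥ₙ`.  (The symmetric two-chart statement of (G-2) is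
`le_weightedMonomialIdeal_iff_forall_minimalPrimes` applied to each chart.) [OURS · DESIGN MEMO v0 §3 (G-2) shape] -/
theorem eq_weightedMonomialIdeal_iff [IsNoetherianRing A] {n : ℕ} {K : Ideal A} :
    K = weightedMonomialIdeal u w n ↔
      weightedMonomialIdeal u w n ≤ K ∧
        ∀ 𝔮 ∈ (Ideal.span (Set.range u)).minimalPrimes, ∀ y ∈ K,
          ∃ s ∉ 𝔮, s * y ∈ weightedMonomialIdeal u w n := by
  rw [← le_weightedMonomialIdeal_iff_forall_minimalPrimes u w hw hloc]
  constructor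
  · rintro rfl; exact ⟨le_rfl, le_rfl⟩
  · rintro ⟨h₁, h₂⟩; exact le_antisymm h₂ h₁

end Chart

end E2Model

end Summit.ResolutionOfSingularities.ResolutionOfSingularities.Cruxes.HypersurfaceCentreConstruction.LocalEngine

end
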